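import Literature.Computability.Cryptography.RegevSamplerGRLabel
import Literature.Computability.Cryptography.RegevSamplerWordFns
import HarnessLib

/-!
# Regev 2009, Lemma 3.14 in machine form: the classical sources of the parameter word in the input zone

Topic `Computability/Cryptography` (family `pqc`), grouping namespace `Regev2009.SamplerRegs`; sequel of
`RegevSamplerGRLabel.lean` (`BlocksFit`: the Grover–Rudolph blocks sit on the point zone and the work window;
`lab₀`: the prepared label — point bits on `X`, the input-zone content `uz` on `U`) and `RegevSamplerWordFns.lean`
(`zoneOf Fq Pa pad = Fq ++ ⟨code Pa⟩ ++ pad`: the input zone, with FREE padding `pad`).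

The data-free machine circuit (`RegevSamplerMachineU/…Par`: the parameter word is erased by `CNOT`s controlled on
classical SOURCE wires) needs sources that (a) lie off the Grover–Rudolph blocks and (b) carry the parameter word in
the prepared label. This file places them in the input zone `U` at a fixed offset `p₀` — inside the padding, which
the classical preprocessing is free to fill:

* `srcU Λ p₀ k := Λ.fin (Λ.oU + (p₀ + k))`; `offBlocks_srcU` — off every block (`BlocksFit`, `p₀ + np ≤ L`);
  `boxLab_lab₀_srcU` — on the sources the block label is the input-zone content: `uz.getD (p₀ + k) false`.
* `padWord g c pad' := 0^g ++ ⟨c⟩ ++ pad'` and `getD_zoneOf_padWord` — with `g := p₀ − |Fq| − |⟨code Pa⟩|` the zone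
  `zoneOf Fq Pa (padWord g c pad')` carries `c k` at position `p₀ + k`;
  `boxLab_lab₀_srcU_eq` — **the prepared label carries the word `c` on the sources** (hypothesis `hz` of
  `runOn_machineCircPar_eq_runOn_machineCirc`).

Everything is proved; no named fact is introduced.
HONEST FRAMING: kernel-checked lemmas of a KNOWN reduction (Regev 2009) — not summit progress.

## References

* O. Regev, *On lattices, learning with errors, random linear codes, and cryptography*, J. ACM 56 (2009), art. 34:
  Lemma 3.14 (proof: the registers) [Regev2009].
* M. A. Nielsen, I. L. Chuang, *Quantum Computation and Quantum Information*, CUP 2010, §3.2.5, §4.3 [NielsenChuang2010].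
-/

noncomputable section

namespace Literature.Computability.Cryptography

namespace Regev2009

namespace SamplerRegs

open Literature.Algebra.EuclideanLattices Literature.Algebra.EuclideanLattices.Regev2009
  Literature.Algebra.EuclideanLattices.Regev2009.QPart Literature.Computability.QuantumComplexity Literature.Computability.Complexity
  SamplerClassical SamplerClassical.Layout SamplerWordFns

variable {W B : ℕ} (I : LatticeInstance) {Λ : Layout W I.n} (hΛ : Λ.OK)

section Src

/-- **The source wires**: positions `p₀, p₀+1, …` of the input zone `U`. [cite: Regev2009, Lemma 3.14 (proof: the registers)] -/
def srcU (Λ : Layout W I.n) (p₀ : ℕ) {np : ℕ} (k : Fin np) : Fin W := Λ.fin (Λ.oU + (p₀ + k))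

include hΛ in
/-- **The sources lie off the Grover–Rudolph blocks**: a block wire is a point-zone wire (index `< n·ℓ = oU`) or lies in
the work window (`≥ base`), while a source is a zone wire of index `≥ oU` (hence below `base`). [folklore] -/
theorem offBlocks_srcU {E : Fin I.n → (Fin B ↪ Fin W)} {ws : Fin Λ.ℓ ↪ Fin B} (hfit : BlocksFit I Λ E ws)
    {p₀ np : ℕ} (hp : p₀ + np ≤ Λ.L) (k : Fin np) : OffBlocks E (srcU I Λ p₀ k) := by
  intro i ⟨q, hq⟩
  have hT := Λ.T_eq
  obtain ⟨hU, -, -, -, -⟩ := offs_eq I Λ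
  have hs : Λ.oU + (p₀ + k) < Λ.T := by have := k.2; omega
  by_cases hqw : q ∈ Set.range ws
  · obtain ⟨j, rfl⟩ := hqw
    rw [hfit.ws_eq i j, srcU] at hq
    have hij : (i : ℕ) * Λ.ℓ + j < I.n * Λ.ℓ := by
      have hi := i.2; have hj := j.2
      calc (i : ℕ) * Λ.ℓ + j < (i : ℕ) * Λ.ℓ + Λ.ℓ := by omega
        _ = ((i : ℕ) + 1) * Λ.ℓ := by ring
        _ ≤ I.n * Λ.ℓ := Nat.mul_le_mul_right _ (by omega)
    have := Layout.fin_inj hΛ (by omega) hs hq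
    omega
  · have h1 := hfit.off_ge i q hqw
    have h2 : ((srcU I Λ p₀ k : Fin W) : ℕ) < Λ.base := fin_lt_base hΛ hs
    rw [← hq] at h2
    omega

include hΛ in
/-- **On a source the block label is the input-zone content.** [folklore] -/
theorem boxLab_lab₀_srcU {E : Fin I.n → (Fin B ↪ Fin W)} {ws : Fin Λ.ℓ ↪ Fin B} (hfit : BlocksFit I Λ E ws)
    {p₀ np : ℕ} (hp : p₀ + np ≤ Λ.L) (x₀ : QReg B) (Y : Fin I.n → Fin Λ.ℓ → Bool) (R : ℕ) (t : ℝ) (uz : List Bool)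
    (x' : EuclideanSpace ℝ (Fin I.n)) (k : Fin np) :
    boxLab E ws x₀ (lab₀ I Λ R t uz x') Y (srcU I Λ p₀ k) = uz.getD (p₀ + k) false := by
  rw [boxLab_apply_off ws x₀ _ Y (offBlocks_srcU I hΛ hfit hp k), srcU, lab₀_U I hΛ R t uz x' (by have := k.2; omega)]

/-- **The padding carrying the word `c` at offset `g`**: `0^g ++ ⟨c⟩ ++ pad'`. [folklore] -/
def padWord (g : ℕ) {np : ℕ} (c : Fin np → Bool) (pad' : List Bool) : List Bool := List.replicate g false ++ (List.ofFn c ++ pad')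

/-- The padded word at its positions. [folklore] -/
theorem getD_padWord (g : ℕ) {np : ℕ} (c : Fin np → Bool) (pad' : List Bool) (k : Fin np) :
    (padWord g c pad').getD (g + k) false = c k := by
  rw [padWord, List.getD_eq_getElem?_getD, List.getElem?_append_right (by rw [List.length_replicate]; omega), List.length_replicate,
    Nat.add_sub_cancel_left, List.getElem?_append_left (by rw [List.length_ofFn]; exact k.2), List.getElem?_ofFn]
  simp [k.2]

/-- **The input zone with the padded word carries `c k` at position `p₀ + k`** whenever the padding offset makes up the
fixed offset `p₀` (`|Fq| + |⟨code Pa⟩| + g = p₀`). [folklore] -/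
theorem getD_zoneOf_padWord (Fq : List Bool) (Pa : PAll) (g : ℕ) {np : ℕ} (c : Fin np → Bool) (pad' : List Bool) {p₀ : ℕ}
    (hg : Fq.length + (boolPair (pallE Pa) []).length + g = p₀) (k : Fin np) :
    (zoneOf Fq Pa (padWord g c pad')).getD (p₀ + k) false = c k := by
  rw [zoneOf, ← List.append_assoc, List.getD_eq_getElem?_getD, List.getElem?_append_right (by rw [List.length_append]; omega),
    List.length_append, show p₀ + k - (Fq.length + (boolPair (pallE Pa) []).length) = g + k by omega, ← List.getD_eq_getElem?_getD,
    getD_padWord]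

include hΛ in
/-- **The prepared label carries the parameter word on the sources** (the hypothesis `hz` of
`runOn_machineCircPar_eq_runOn_machineCirc`): for the input zone `zoneOf Fq Pa (padWord g c pad')` with
`|Fq| + |⟨code Pa⟩| + g = p₀` and `p₀ + np ≤ L`. [cite: Regev2009, Lemma 3.14 (proof: the registers)] [cite: NielsenChuang2010, §3.2.5] -/
theorem boxLab_lab₀_srcU_eq {E : Fin I.n → (Fin B ↪ Fin W)} {ws : Fin Λ.ℓ ↪ Fin B} (hfit : BlocksFit I Λ E ws)
    {p₀ np : ℕ} (hp : p₀ + np ≤ Λ.L) (x₀ : QReg B) (Y : Fin I.n → Fin Λ.ℓ → Bool) (R : ℕ) (t : ℝ)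
    (Fq : List Bool) (Pa : PAll) (g : ℕ) (c : Fin np → Bool) (pad' : List Bool)
    (hg : Fq.length + (boolPair (pallE Pa) []).length + g = p₀) (x' : EuclideanSpace ℝ (Fin I.n)) :
    ∀ k : Fin np, boxLab E ws x₀ (lab₀ I Λ R t (zoneOf Fq Pa (padWord g c pad')) x') Y (srcU I Λ p₀ k) = c k := fun k => by
  rw [boxLab_lab₀_srcU I hΛ hfit hp, getD_zoneOf_padWord Fq Pa g c pad' hg]

/-- The length of the padded input zone. [folklore] -/
theorem length_zoneOf_padWord (Fq : List Bool) (Pa : PAll) (g : ℕ) {np : ℕ} (c : Fin np → Bool) (pad' : List Bool) {p₀ : ℕ}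
    (hg : Fq.length + (boolPair (pallE Pa) []).length + g = p₀) :
    (zoneOf Fq Pa (padWord g c pad')).length = p₀ + np + pad'.length := by
  simp only [zoneOf, padWord, List.length_append, List.length_replicate, List.length_ofFn]
  omega

end Src

end SamplerRegs

end Regev2009

end Literature.Computability.Cryptography

end
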